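import Literature.Probability.RandomPlanarGeometry.SAWBridgeSpanDecayEngine
import Mathlib.Analysis.SpecificLimits.Normed
import HarnessLib

/-!
# The span-decay engine under a CESÀRO hypothesis: `Σ_{B ≤ A} V_M(z_c;B) ≤ C (A+1)^{1−η}` suffices

Topic `Literature/Probability/RandomPlanarGeometry` (continues `SAWBridgeSpanDecayEngine.lean`, the pointwise
engine `Zd.count_le_stretched_of_spanDecayRate`: a span-decay rate `V_M(z_c;A) ≤ C A^{-η}` of the truncated
critical span-`A` bridge generating functions gives `c_N ≤ A e^{K N^{(1−η)/(2−η)}} μ^N` for all `N ≥ 1`).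
Source shape: T. Hutchcroft, *The Hammersley–Welsh bound for self-avoiding walk revisited*, Electron. Commun.
Probab. 23 (2018), §2 (Proposition 2.1, eq. (2.6), Lemma 2.3, proof of Theorem 1.4: the bridge product at
`z = (1−ε)z_c` controlled through the span-resolved generating functions `a(z;n) ≤ (1−ε)^n a(z_c;n)`).

This file proves that the SAME stretched exponent follows from the WEAKER, Cesàro-averaged hypothesis
`BridgeSpanCesaroRate d C η : ∀ A M, Σ_{B=0}^{A} V_M(z_c;B) ≤ C (A+1)^{1−η}` — one Abel summation:
`Σ_{A=1}^{M} s^A V(A) = s^M U(M) − U(0) + (1−s) Σ_{A<M} s^A U(A)` with `U(A) = Σ_{B≤A} V(B)`, `s = 1 − t`, and the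
elementary bound `(A+1)^{1−η} ≤ 2t^{η−1} + (A+1) t^{η}` (split at `A + 1 = 1/t`), so that
`B⁺_M((1−t)z_c) ≤ 6C · t^{η−1}`; the rest of the chain (`sum_count_le_exp`, `t := ½ N^{-1/(2−η)}`) is the
pointwise engine's, verbatim.

* `BridgeSpanCesaroRate d C η` (hypothesis schema; lane «pcv-sawmu» Sketch_G12 §R61 verbatim), `.nonneg`;
* `bridgeSpanCesaroRate_of_decayRate` — pointwise ⇒ Cesàro with `C ↦ 1 + C/(1−η)`;
* **`bridgeGFpos_subcrit_le_of_spanCesaroRate`** — `B⁺_M((1−t)z_c) ≤ 6C t^{η−1}` (`0 < t ≤ 1/2`), and its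
  `∃ K` face `exists_bridgeGFpos_subcrit_le_of_spanCesaroRate`;
* `count_le_exp_of_spanCesaroRate`, **`count_le_stretched_of_spanCesaroRate_explicit`**
  (`c_N ≤ (e μ)·exp((1 + 24C) N^{(1−η)/(2−η)})·μ^N`, all `N ≥ 1`) and the `∃ A K` form
  **`count_le_stretched_of_spanCesaroRate`**.

Why the Cesàro form matters (lane route R61, a-idea-1 ROUTES-G12): by the span-Erickson sandwich the Cesàro
sum `U(A)` is `≍ (A+1)/m_A` with `m_A` the truncated mean span of a Kesten-irreducible bridge, so the weakest
door to an all-`N` sub-`√N` Hammersley–Welsh bound reads «irreducible bridges are tall on average». Printed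
status: conditional engine (no `η > 0` is proved on `ℤ^d`, `d ≤ 4`); mechanism Hutchcroft 2018 §2; the Cesàro
weakening is bookkeeping not found in print as a statement.
-/

noncomputable section

open Finset
open Literature.Probability.RandomPlanarGeometry.SAW
open Literature.Probability.LatticeModels Literature.Probability.Percolation
open scoped BigOperators

namespace Literature.Probability.RandomPlanarGeometry.SAW.Zd

variable {d : ℕ} [NeZero d]

/-! ### The Cesàro hypothesis -/

/-- **CESÀRO span-decay hypothesis with a rate** (weaker than the pointwise `BridgeSpanDecayRate d C η`):
`Σ_{B ≤ A} V_M(z_c;B) ≤ C (A+1)^{1−η}` for all `A`, uniformly in the truncation `M`. A hypothesis schema, not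
a fact. [cite: Hutchcroft2018HammersleyWelsh, §2.1 eq. (2.2) and Lemma 2.3 (the span-resolved generating functions)] -/
def BridgeSpanCesaroRate (d : ℕ) [NeZero d] (C η : ℝ) : Prop :=
  ∀ A M : ℕ, ∑ B ∈ Finset.range (A + 1), brGF d M (connectiveConstant d)⁻¹ (B : ℤ) ≤ C * ((A : ℝ) + 1) ^ (1 - η)

/-- The constant of a Cesàro rate is nonnegative (`A = 0`: `0 ≤ V_M(z_c;0) ≤ C`).
[cite: Hutchcroft2018HammersleyWelsh, §2.1] -/
theorem BridgeSpanCesaroRate.nonneg {C η : ℝ} (h : BridgeSpanCesaroRate d C η) : 0 ≤ C := by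
  have h0 := h 0 0
  have hV : 0 ≤ brGF d 0 (connectiveConstant d)⁻¹ ((0 : ℕ) : ℤ) :=
    brGF_nonneg 0 (inv_nonneg.2 (connectiveConstant_pos d).le) _
  simp only [zero_add, Finset.sum_range_one, Nat.cast_zero, Real.one_rpow, mul_one] at h0
  linarith

/-! ### Pointwise ⇒ Cesàro -/

/-- `Σ_{T=1}^{M} T^{-η} ≤ M^{1−η}/(1−η)` for `0 < η < 1` (Bernoulli-inequality induction). [folklore] -/
private theorem sum_rpow_neg_le_cesaro {η : ℝ} (hη0 : 0 < η) (hη1 : η < 1) (M : ℕ) :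
    ∑ T ∈ range M, ((T : ℝ) + 1) ^ (-η) ≤ ((M : ℝ)) ^ (1 - η) / (1 - η) := by
  have h1η : 0 < 1 - η := by linarith
  induction M with
  | zero => simp [Real.zero_rpow h1η.ne']
  | succ M ih =>
    rw [sum_range_succ]
    push_cast
    have hM1 : (0 : ℝ) < (M : ℝ) + 1 := by positivity
    have key : (M : ℝ) ^ (1 - η) + (1 - η) * ((M : ℝ) + 1) ^ (-η) ≤ ((M : ℝ) + 1) ^ (1 - η) := by
      rcases Nat.eq_zero_or_pos M with hM | hM
      · subst hM
        simp only [CharP.cast_eq_zero, Real.zero_rpow h1η.ne', zero_add, Real.one_rpow, mul_one]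
        linarith
      · have hMpos : (0 : ℝ) < M := by exact_mod_cast hM
        have hB := rpow_one_add_le_one_add_mul_self (s := (M : ℝ)⁻¹)
          (by linarith [inv_pos.2 hMpos]) hη0.le hη1.le
        have hsplit : ((M : ℝ) + 1) = M * (1 + (M : ℝ)⁻¹) := by field_simp
        have e1 : ((M : ℝ) + 1) ^ (1 - η) = ((M : ℝ) + 1) * ((M : ℝ) + 1) ^ (-η) := by
          rw [sub_eq_add_neg, Real.rpow_add hM1, Real.rpow_one]
        have e2 : (M : ℝ) ^ (1 - η) = (M : ℝ) * (M : ℝ) ^ (-η) := by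
          rw [sub_eq_add_neg, Real.rpow_add hMpos, Real.rpow_one]
        have e3 : (M : ℝ) ^ (-η) = ((M : ℝ) + 1) ^ (-η) * (1 + (M : ℝ)⁻¹) ^ η := by
          rw [hsplit, Real.mul_rpow hMpos.le (by positivity), mul_assoc, ← Real.rpow_add (by positivity),
            neg_add_cancel, Real.rpow_zero, mul_one]
        rw [e1, e2, e3]
        have hpos : 0 ≤ ((M : ℝ) + 1) ^ (-η) := Real.rpow_nonneg hM1.le _
        have : (M : ℝ) * (1 + (M : ℝ)⁻¹) ^ η ≤ M + η := by
          calc (M : ℝ) * (1 + (M : ℝ)⁻¹) ^ η ≤ M * (1 + η * (M : ℝ)⁻¹) :=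
                mul_le_mul_of_nonneg_left hB hMpos.le
            _ = M + η := by field_simp
        nlinarith
    calc ∑ T ∈ range M, ((T : ℝ) + 1) ^ (-η) + ((M : ℝ) + 1) ^ (-η)
        ≤ (M : ℝ) ^ (1 - η) / (1 - η) + ((M : ℝ) + 1) ^ (-η) := by linarith
      _ ≤ ((M : ℝ) + 1) ^ (1 - η) / (1 - η) := by
          rw [div_add' _ _ _ h1η.ne', div_le_div_iff_of_pos_right h1η]
          linarith

/-- **Pointwise ⇒ Cesàro**: `V_M(z_c;A) ≤ C A^{-η}` (`A ≥ 1`, `0 ≤ C`, `0 < η < 1`) gives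
`Σ_{B ≤ A} V_M(z_c;B) ≤ (1 + C/(1−η)) (A+1)^{1−η}` (`V_M(z_c;0) ≤ 1` by Lemma 2.3, `Σ_{B=1}^{A} B^{-η} ≤ A^{1−η}/(1−η)`).
[cite: Hutchcroft2018HammersleyWelsh, Lemma 2.3] -/
theorem bridgeSpanCesaroRate_of_decayRate {C η : ℝ} (hC : 0 ≤ C) (hη0 : 0 < η) (hη1 : η < 1)
    (h : BridgeSpanDecayRate d C η) : BridgeSpanCesaroRate d (1 + C / (1 - η)) η := by
  intro A M
  have h1η : 0 < 1 - η := by linarith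
  have hA0 : (0 : ℝ) ≤ A := Nat.cast_nonneg A
  have hA1 : (1 : ℝ) ≤ (A : ℝ) + 1 := by linarith
  have hV0 : brGF d M (connectiveConstant d)⁻¹ ((0 : ℕ) : ℤ) ≤ 1 := brGF_critical_le_one M _
  have htail : ∑ B ∈ range A, brGF d M (connectiveConstant d)⁻¹ ((B + 1 : ℕ) : ℤ) ≤
      C * ((A : ℝ) ^ (1 - η) / (1 - η)) := by
    calc ∑ B ∈ range A, brGF d M (connectiveConstant d)⁻¹ ((B + 1 : ℕ) : ℤ)
        ≤ ∑ B ∈ range A, C * ((B : ℝ) + 1) ^ (-η) := by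
          refine sum_le_sum fun B _ => ?_
          have := h (B + 1) (by omega) M
          push_cast at this ⊢
          exact this
      _ = C * ∑ B ∈ range A, ((B : ℝ) + 1) ^ (-η) := by rw [mul_sum]
      _ ≤ C * ((A : ℝ) ^ (1 - η) / (1 - η)) :=
          mul_le_mul_of_nonneg_left (sum_rpow_neg_le_cesaro hη0 hη1 A) hC
  have hpow1 : (1 : ℝ) ≤ ((A : ℝ) + 1) ^ (1 - η) := Real.one_le_rpow hA1 h1η.le
  have hpow2 : (A : ℝ) ^ (1 - η) ≤ ((A : ℝ) + 1) ^ (1 - η) :=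
    Real.rpow_le_rpow hA0 (by linarith) h1η.le
  rw [sum_range_succ']
  calc ∑ B ∈ range A, brGF d M (connectiveConstant d)⁻¹ ((B + 1 : ℕ) : ℤ) +
        brGF d M (connectiveConstant d)⁻¹ ((0 : ℕ) : ℤ)
      ≤ C * ((A : ℝ) ^ (1 - η) / (1 - η)) + 1 := add_le_add htail hV0
    _ ≤ C * (((A : ℝ) + 1) ^ (1 - η) / (1 - η)) + ((A : ℝ) + 1) ^ (1 - η) :=
        add_le_add (mul_le_mul_of_nonneg_left (div_le_div_of_nonneg_right hpow2 h1η.le) hC) hpow1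
    _ = (1 + C / (1 - η)) * ((A : ℝ) + 1) ^ (1 - η) := by ring

/-! ### Elementary sums for the Abel summation -/

/-- `(a+1)^{1−η} ≤ 2 t^{η−1} + (a+1) t^{η}` for `0 < t ≤ 1/2`, `0 < η < 1` (split at `a + 1 = 1/t`). [folklore] -/
private theorem rpow_one_sub_le_split {t η : ℝ} (ht0 : 0 < t) (hη0 : 0 < η) (hη1 : η < 1) (a : ℕ) :
    ((a : ℝ) + 1) ^ (1 - η) ≤ 2 * t ^ (η - 1) + ((a : ℝ) + 1) * t ^ η := by
  have ha0 : (0 : ℝ) < (a : ℝ) + 1 := by positivity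
  have hA : 0 ≤ 2 * t ^ (η - 1) := by positivity
  have hB : 0 ≤ ((a : ℝ) + 1) * t ^ η := by positivity
  rcases le_or_gt ((a : ℝ) + 1) t⁻¹ with hle | hgt
  · -- `a + 1 ≤ 1/t`: `(a+1)^{1-η} ≤ (1/t)^{1-η} = t^{η-1}`
    have h1 : ((a : ℝ) + 1) ^ (1 - η) ≤ (t⁻¹) ^ (1 - η) := Real.rpow_le_rpow ha0.le hle (by linarith)
    have h2 : (t⁻¹) ^ (1 - η) = t ^ (η - 1) := by
      rw [Real.inv_rpow ht0.le, ← Real.rpow_neg ht0.le, neg_sub]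
    rw [h2] at h1
    linarith [Real.rpow_nonneg ht0.le (η - 1)]
  · -- `a + 1 > 1/t`: `(a+1)^{1-η} = (a+1) (a+1)^{-η} ≤ (a+1) t^{η}`
    have h1 : ((a : ℝ) + 1) ^ (1 - η) = ((a : ℝ) + 1) * ((a : ℝ) + 1) ^ (-η) := by
      rw [sub_eq_add_neg, Real.rpow_add ha0, Real.rpow_one]
    have h2 : ((a : ℝ) + 1) ^ (-η) ≤ (t⁻¹) ^ (-η) :=
      Real.rpow_le_rpow_of_nonpos (inv_pos.2 ht0) hgt.le (by linarith)
    have h3 : (t⁻¹) ^ (-η) = t ^ η := by rw [Real.inv_rpow ht0.le, ← Real.rpow_neg ht0.le, neg_neg]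
    rw [h3] at h2
    rw [h1]
    linarith [mul_le_mul_of_nonneg_left h2 ha0.le]

/-- `Σ_{a<M} s^a ≤ 1/t` for `s = 1 − t`, `0 < t ≤ 1`. [folklore] -/
private theorem geom_sum_le_inv {t : ℝ} (ht0 : 0 < t) (ht1 : t ≤ 1) (M : ℕ) :
    ∑ a ∈ range M, (1 - t) ^ a ≤ t⁻¹ := by
  have hs0 : 0 ≤ 1 - t := by linarith
  have hs1 : 1 - t < 1 := by linarith
  have h := geom_sum_Ico_le_of_lt_one (m := 0) (n := M) hs0 hs1
  rw [Finset.range_eq_Ico]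
  refine h.trans (le_of_eq ?_)
  rw [pow_zero, sub_sub_cancel, one_div]

/-- `Σ_{a<M} (a+1) s^a ≤ 1/t²` for `s = 1 − t`, `0 < t ≤ 1`. [folklore] -/
private theorem arith_geom_sum_le_inv_sq {t : ℝ} (ht0 : 0 < t) (ht1 : t ≤ 1) (M : ℕ) :
    ∑ a ∈ range M, ((a : ℝ) + 1) * (1 - t) ^ a ≤ t⁻¹ ^ 2 := by
  set s : ℝ := 1 - t with hs
  have hs0 : 0 ≤ s := by rw [hs]; linarith
  have hs1 : ‖s‖ < 1 := by rw [Real.norm_of_nonneg hs0, hs]; linarith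
  have h1 : HasSum (fun n : ℕ => (n : ℝ) * s ^ n) (s / (1 - s) ^ 2) := hasSum_coe_mul_geometric_of_norm_lt_one hs1
  have h2 : HasSum (fun n : ℕ => s ^ n) (1 - s)⁻¹ := hasSum_geometric_of_norm_lt_one hs1
  have h3 : HasSum (fun n : ℕ => ((n : ℝ) + 1) * s ^ n) (s / (1 - s) ^ 2 + (1 - s)⁻¹) := by
    convert h1.add h2 using 1
    funext n; ring
  have hval : s / (1 - s) ^ 2 + (1 - s)⁻¹ = t⁻¹ ^ 2 := by
    have ht : 1 - s = t := by rw [hs]; ring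
    rw [ht]; field_simp; rw [hs]; ring
  rw [← hval]
  exact sum_le_hasSum (range M) (fun n _ => by positivity) h3

/-- `s^M (M+1) ≤ 1/t` for `s = 1 − t`, `0 < t ≤ 1`. [folklore] -/
private theorem pow_mul_succ_le_inv {t : ℝ} (ht0 : 0 < t) (ht1 : t ≤ 1) (M : ℕ) :
    (1 - t) ^ M * ((M : ℝ) + 1) ≤ t⁻¹ := by
  have hs0 : 0 ≤ 1 - t := by linarith
  have hs1 : 1 - t ≤ 1 := by linarith
  calc (1 - t) ^ M * ((M : ℝ) + 1) = ∑ _a ∈ range (M + 1), (1 - t) ^ M := by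
        rw [sum_const, card_range, nsmul_eq_mul]; push_cast; ring
    _ ≤ ∑ a ∈ range (M + 1), (1 - t) ^ a :=
        sum_le_sum fun a ha => pow_le_pow_of_le_one hs0 hs1 (by rw [mem_range] at ha; omega)
    _ ≤ t⁻¹ := geom_sum_le_inv ht0 ht1 (M + 1)

/-- ABEL SUMMATION (as an identity): with `U(A) = Σ_{B ≤ A} V(B)` and `s = 1 − t`,
`Σ_{a<M} s^{a+1} (U(a+1) − U(a)) = s^M U(M) + t Σ_{a<M} s^a U(a) − U(0)`. [folklore] -/
private theorem abel_identity (U : ℕ → ℝ) (t : ℝ) (M : ℕ) :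
    ∑ a ∈ range M, (1 - t) ^ (a + 1) * (U (a + 1) - U a) =
      (1 - t) ^ M * U M + t * ∑ a ∈ range M, (1 - t) ^ a * U a - U 0 := by
  induction M with
  | zero => simp
  | succ M ih =>
    rw [sum_range_succ, sum_range_succ, ih]
    ring

/-! ### The generating-function bound under the Cesàro hypothesis -/

/-- **`B⁺_M((1−t)z_c) ≤ 6C · t^{η−1}`** for `0 < t ≤ 1/2` and every truncation `M`, under the Cesàro rate
`Σ_{B≤A} V_M(z_c;B) ≤ C (A+1)^{1−η}` (`0 < η < 1`): `B⁺ ≤ Σ_{A=1}^{M} (1−t)^A V(A)` (span `≤` length), then Abel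
summation against `U(A) = Σ_{B≤A} V(B)` and `(A+1)^{1−η} ≤ 2t^{η−1} + (A+1)t^η`.
[cite: Hutchcroft2018HammersleyWelsh, proof of Theorem 1.4 (first display)] -/
theorem bridgeGFpos_subcrit_le_of_spanCesaroRate {C η : ℝ} (h : BridgeSpanCesaroRate d C η)
    (hη0 : 0 < η) (hη1 : η < 1) {t : ℝ} (ht0 : 0 < t) (ht : t ≤ 1 / 2) (M : ℕ) :
    bridgeGFpos d M ((1 - t) * (connectiveConstant d)⁻¹) ≤ 6 * C * t ^ (η - 1) := by
  have hμ := connectiveConstant_pos d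
  have hC := h.nonneg
  have ht1 : t ≤ 1 := by linarith
  have h1t : 0 ≤ 1 - t := by linarith
  have h1t1 : 1 - t ≤ 1 := by linarith
  have hz : 0 ≤ (1 - t) * (connectiveConstant d)⁻¹ := mul_nonneg h1t (inv_nonneg.2 hμ.le)
  -- abbreviations
  set V : ℕ → ℝ := fun A => brGF d M (connectiveConstant d)⁻¹ (A : ℤ) with hV
  set U : ℕ → ℝ := fun A => ∑ B ∈ range (A + 1), V B with hU
  have hV0 : ∀ A, 0 ≤ V A := fun A => brGF_nonneg M (inv_nonneg.2 hμ.le) _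
  have hU0 : ∀ A, 0 ≤ U A := fun A => sum_nonneg fun B _ => hV0 B
  have hUle : ∀ A, U A ≤ C * ((A : ℝ) + 1) ^ (1 - η) := fun A => h A M
  have hUV : ∀ a, U (a + 1) - U a = V (a + 1) := by
    intro a; simp only [hU]; rw [sum_range_succ]; ring
  have htη1 : 0 ≤ t ^ (η - 1) := Real.rpow_nonneg ht0.le _
  have htη : 0 ≤ t ^ η := Real.rpow_nonneg ht0.le _
  have htη_mul : t ^ η * t⁻¹ = t ^ (η - 1) := by
    rw [sub_eq_add_neg, Real.rpow_add ht0, Real.rpow_neg_one]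
  -- step 1: `B⁺ ≤ Σ_{a<M} s^{a+1} V(a+1)`
  have h1 : bridgeGFpos d M ((1 - t) * (connectiveConstant d)⁻¹) ≤
      ∑ a ∈ range M, (1 - t) ^ (a + 1) * V (a + 1) := by
    refine (bridgeGFpos_le_sum_brGF M hz).trans (sum_le_sum fun a _ => ?_)
    exact brGF_smul_le_pow_mul M h1t h1t1 (inv_nonneg.2 hμ.le) (a + 1)
  -- step 2: Abel summation, dropping `-U(0) ≤ 0`
  have h2 : ∑ a ∈ range M, (1 - t) ^ (a + 1) * V (a + 1) ≤
      (1 - t) ^ M * U M + t * ∑ a ∈ range M, (1 - t) ^ a * U a := by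
    have e : ∑ a ∈ range M, (1 - t) ^ (a + 1) * V (a + 1) =
        ∑ a ∈ range M, (1 - t) ^ (a + 1) * (U (a + 1) - U a) :=
      sum_congr rfl fun a _ => by rw [hUV]
    rw [e, abel_identity U t M]
    linarith [hU0 0]
  -- step 3: insert the Cesàro bound and the elementary sums
  have h3a : (1 - t) ^ M * U M ≤ C * (3 * t ^ (η - 1)) := by
    have hsM : 0 ≤ (1 - t) ^ M := pow_nonneg h1t M
    have hsM1 : (1 - t) ^ M ≤ 1 := pow_le_one₀ h1t h1t1
    calc (1 - t) ^ M * U M ≤ (1 - t) ^ M * (C * ((M : ℝ) + 1) ^ (1 - η)) :=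
          mul_le_mul_of_nonneg_left (hUle M) hsM
      _ = C * ((1 - t) ^ M * ((M : ℝ) + 1) ^ (1 - η)) := by ring
      _ ≤ C * ((1 - t) ^ M * (2 * t ^ (η - 1) + ((M : ℝ) + 1) * t ^ η)) :=
          mul_le_mul_of_nonneg_left (mul_le_mul_of_nonneg_left (rpow_one_sub_le_split ht0 hη0 hη1 M) hsM) hC
      _ = C * ((1 - t) ^ M * (2 * t ^ (η - 1)) + ((1 - t) ^ M * ((M : ℝ) + 1)) * t ^ η) := by ring
      _ ≤ C * (1 * (2 * t ^ (η - 1)) + t⁻¹ * t ^ η) := by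
          refine mul_le_mul_of_nonneg_left (add_le_add ?_ ?_) hC
          · exact mul_le_mul_of_nonneg_right hsM1 (by positivity)
          · exact mul_le_mul_of_nonneg_right (pow_mul_succ_le_inv ht0 ht1 M) htη
      _ = C * (3 * t ^ (η - 1)) := by rw [mul_comm t⁻¹, htη_mul]; ring
  have h3b : t * ∑ a ∈ range M, (1 - t) ^ a * U a ≤ C * (3 * t ^ (η - 1)) := by
    have hterm : ∀ a ∈ range M, (1 - t) ^ a * U a ≤
        C * (2 * t ^ (η - 1) * (1 - t) ^ a + t ^ η * (((a : ℝ) + 1) * (1 - t) ^ a)) := by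
      intro a _
      have hsa : 0 ≤ (1 - t) ^ a := pow_nonneg h1t a
      calc (1 - t) ^ a * U a ≤ (1 - t) ^ a * (C * ((a : ℝ) + 1) ^ (1 - η)) :=
            mul_le_mul_of_nonneg_left (hUle a) hsa
        _ ≤ (1 - t) ^ a * (C * (2 * t ^ (η - 1) + ((a : ℝ) + 1) * t ^ η)) :=
            mul_le_mul_of_nonneg_left (mul_le_mul_of_nonneg_left (rpow_one_sub_le_split ht0 hη0 hη1 a) hC) hsa
        _ = C * (2 * t ^ (η - 1) * (1 - t) ^ a + t ^ η * (((a : ℝ) + 1) * (1 - t) ^ a)) := by ring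
    have hsum : ∑ a ∈ range M, (1 - t) ^ a * U a ≤
        C * (2 * t ^ (η - 1) * t⁻¹ + t ^ η * t⁻¹ ^ 2) := by
      calc ∑ a ∈ range M, (1 - t) ^ a * U a
          ≤ ∑ a ∈ range M, C * (2 * t ^ (η - 1) * (1 - t) ^ a + t ^ η * (((a : ℝ) + 1) * (1 - t) ^ a)) :=
            sum_le_sum hterm
        _ = C * (2 * t ^ (η - 1) * ∑ a ∈ range M, (1 - t) ^ a +
              t ^ η * ∑ a ∈ range M, ((a : ℝ) + 1) * (1 - t) ^ a) := by
            rw [← mul_sum, sum_add_distrib, ← mul_sum, ← mul_sum]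
        _ ≤ C * (2 * t ^ (η - 1) * t⁻¹ + t ^ η * t⁻¹ ^ 2) := by
            refine mul_le_mul_of_nonneg_left (add_le_add ?_ ?_) hC
            · exact mul_le_mul_of_nonneg_left (geom_sum_le_inv ht0 ht1 M) (by positivity)
            · exact mul_le_mul_of_nonneg_left (arith_geom_sum_le_inv_sq ht0 ht1 M) htη
    have ht0' : t ≠ 0 := ht0.ne'
    have e : t * (C * (2 * t ^ (η - 1) * t⁻¹ + t ^ η * t⁻¹ ^ 2)) = C * (3 * t ^ (η - 1)) := by
      rw [← htη_mul]; field_simp; ring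
    calc t * ∑ a ∈ range M, (1 - t) ^ a * U a
        ≤ t * (C * (2 * t ^ (η - 1) * t⁻¹ + t ^ η * t⁻¹ ^ 2)) := mul_le_mul_of_nonneg_left hsum ht0.le
      _ = C * (3 * t ^ (η - 1)) := e
  calc bridgeGFpos d M ((1 - t) * (connectiveConstant d)⁻¹)
      ≤ (1 - t) ^ M * U M + t * ∑ a ∈ range M, (1 - t) ^ a * U a := h1.trans h2
    _ ≤ C * (3 * t ^ (η - 1)) + C * (3 * t ^ (η - 1)) := add_le_add h3a h3b
    _ = 6 * C * t ^ (η - 1) := by ring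

/-- The `∃ K` face of the generating-function bound (lane «pcv-sawmu» Sketch_G12 §R61 (c″)): under a Cesàro
rate with `0 < η < 1`, `∃ K, ∀ t ∈ (0, 1/2], ∀ M, B⁺_M((1−t)z_c) ≤ K t^{η−1}` (`K = 6C`).
[cite: Hutchcroft2018HammersleyWelsh, proof of Theorem 1.4 (first display)] -/
theorem exists_bridgeGFpos_subcrit_le_of_spanCesaroRate {C η : ℝ} (hη0 : 0 < η) (hη1 : η < 1)
    (h : BridgeSpanCesaroRate d C η) :
    ∃ K : ℝ, ∀ t : ℝ, 0 < t → t ≤ 1 / 2 → ∀ M : ℕ,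
      bridgeGFpos d M ((1 - t) * (connectiveConstant d)⁻¹) ≤ K * t ^ (η - 1) :=
  ⟨6 * C, fun _ ht0 ht M => bridgeGFpos_subcrit_le_of_spanCesaroRate h hη0 hη1 ht0 ht M⟩

/-! ### The count bound: the pointwise engine's chain, verbatim -/

/-- **Finite form before optimising in `t`**, under the Cesàro rate (`0 < η < 1`): for every `0 < t ≤ 1/2`
and every `N`, `c_N ≤ exp(12 C t^{η−1}) · μ^{N+1} / (1−t)^{N+1}` (Proposition 2.1 = tree `sum_count_le_exp`, and
the trivial inequality (2.6) at `z = (1−t)z_c`). [cite: Hutchcroft2018HammersleyWelsh, Proposition 2.1, eq. (2.6) and Theorem 1.4] -/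
theorem count_le_exp_of_spanCesaroRate {C η : ℝ} (h : BridgeSpanCesaroRate d C η)
    (hη0 : 0 < η) (hη1 : η < 1) {t : ℝ} (ht0 : 0 < t) (ht : t ≤ 1 / 2) (N : ℕ) :
    (count d N : ℝ) ≤ Real.exp (2 * (6 * C * t ^ (η - 1))) *
      (connectiveConstant d ^ (N + 1) / (1 - t) ^ (N + 1)) := by
  have hμ := connectiveConstant_pos d
  have h1t : 0 < 1 - t := by linarith
  set z : ℝ := (1 - t) * (connectiveConstant d)⁻¹ with hzdef
  have hz : 0 < z := mul_pos h1t (inv_pos.2 hμ)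
  have h1 := sum_count_le_exp (d := d) N hz.le
  have h2 : bridgeGFpos d (N + 1) z ≤ 6 * C * t ^ (η - 1) :=
    bridgeGFpos_subcrit_le_of_spanCesaroRate h hη0 hη1 ht0 ht (N + 1)
  have h3 : (count d N : ℝ) * z ^ (N + 1) ≤
      ∑ n ∈ Finset.range (N + 1), (count d n : ℝ) * z ^ (n + 1) :=
    Finset.single_le_sum (f := fun n => (count d n : ℝ) * z ^ (n + 1))
      (fun n _ => by positivity) (Finset.mem_range.2 (Nat.lt_succ_self N))
  have h4 : (count d N : ℝ) * z ^ (N + 1) ≤ Real.exp (2 * (6 * C * t ^ (η - 1))) :=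
    h3.trans (h1.trans (Real.exp_le_exp.2 (by linarith)))
  have hzpow : z ^ (N + 1) = (1 - t) ^ (N + 1) / connectiveConstant d ^ (N + 1) := by
    rw [hzdef, mul_pow, inv_pow, div_eq_mul_inv]
  rw [hzpow, ← le_div_iff₀ (div_pos (pow_pos h1t _) (pow_pos hμ _))] at h4
  rwa [div_div_eq_mul_div, mul_div_assoc] at h4

/-- **THE CESÀRO ENGINE, CLOSED FORM**: a Cesàro span-decay rate `Σ_{B≤A} V_M(z_c;B) ≤ C (A+1)^{1−η}`
(`0 < η < 1`) gives the stretched Hammersley–Welsh exponent `θ = (1−η)/(2−η)` for ALL `N ≥ 1`: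
`c_N ≤ (e·μ)·exp((1 + 24C) N^θ)·μ^N` (`t := ½ N^{-1/(2−η)}`; `(1−t)^{-(N+1)} ≤ e·e^{N^θ}`, `t^{η−1} ≤ 2N^θ`).
[cite: Hutchcroft2018HammersleyWelsh, Theorem 1.4 and Corollary 1.5 (mechanism); HammersleyWelsh1962, Theorem] -/
theorem count_le_stretched_of_spanCesaroRate_explicit {C η : ℝ} (h : BridgeSpanCesaroRate d C η)
    (hη0 : 0 < η) (hη1 : η < 1) (N : ℕ) (hN : 1 ≤ N) :
    (count d N : ℝ) ≤ (Real.exp 1 * connectiveConstant d) *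
      Real.exp ((1 + 24 * C) * (N : ℝ) ^ ((1 - η) / (2 - η))) * connectiveConstant d ^ N := by
  set μ := connectiveConstant d with hμdef
  have hμpos : 0 < μ := connectiveConstant_pos d
  have hC := h.nonneg
  have h1η : 0 < 1 - η := by linarith
  have h2η : 0 < 2 - η := by linarith
  set θ := (1 - η) / (2 - η) with hθ
  have hNpos : (0 : ℝ) < N := by exact_mod_cast hN
  set t := (1 / 2 : ℝ) * (N : ℝ) ^ (-(1 : ℝ) / (2 - η)) with htdef
  have hNr : (N : ℝ) ^ (-(1 : ℝ) / (2 - η)) ≤ 1 :=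
    Real.rpow_le_one_of_one_le_of_nonpos (by exact_mod_cast hN) (by
      rw [neg_div]; exact neg_nonpos.2 (div_nonneg zero_le_one h2η.le))
  have hNr0 : 0 < (N : ℝ) ^ (-(1 : ℝ) / (2 - η)) := Real.rpow_pos_of_pos hNpos _
  have ht0 : 0 < t := by positivity
  have ht : t ≤ 1 / 2 := by rw [htdef]; nlinarith
  have h1t : 0 < 1 - t := by linarith
  have hmain := count_le_exp_of_spanCesaroRate h hη0 hη1 ht0 ht N
  have hexp1 : (1 : ℝ) + -(1 : ℝ) / (2 - η) = θ := by rw [hθ]; field_simp; ring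
  have hNN : (N : ℝ) * (N : ℝ) ^ (-(1 : ℝ) / (2 - η)) = (N : ℝ) ^ θ := by
    rw [← hexp1, Real.rpow_add hNpos, Real.rpow_one]
  have hNt : (N : ℝ) * t = (1 / 2) * (N : ℝ) ^ θ := by
    rw [htdef, ← hNN]; ring
  have htη : t ^ (η - 1) ≤ 2 * (N : ℝ) ^ θ := by
    rw [htdef, Real.mul_rpow (by norm_num) hNr0.le, ← Real.rpow_mul hNpos.le]
    have e : -(1 : ℝ) / (2 - η) * (η - 1) = θ := by rw [hθ]; field_simp; ring
    rw [e]
    have h2 : (1 / 2 : ℝ) ^ (η - 1) ≤ 2 := by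
      rw [one_div, Real.inv_rpow (by norm_num), ← Real.rpow_neg (by norm_num), neg_sub]
      calc (2 : ℝ) ^ (1 - η) ≤ (2 : ℝ) ^ (1 : ℝ) :=
            Real.rpow_le_rpow_of_exponent_le (by norm_num) (by linarith)
        _ = 2 := Real.rpow_one 2
    exact mul_le_mul_of_nonneg_right h2 (Real.rpow_nonneg hNpos.le _)
  have hNθ1 : 1 ≤ (N : ℝ) ^ θ := Real.one_le_rpow (by exact_mod_cast hN) (div_nonneg h1η.le h2η.le)
  have hNθ0 : 0 ≤ (N : ℝ) ^ θ := by linarith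
  have hinv1t : (1 - t)⁻¹ ≤ Real.exp (2 * t) := by
    have h1 : (1 - t)⁻¹ ≤ 1 + 2 * t := by
      rw [inv_le_comm₀ h1t (by linarith), ← one_div, div_le_iff₀ (by linarith : (0:ℝ) < 1 + 2 * t)]
      nlinarith
    exact h1.trans (by linarith [Real.add_one_le_exp (2 * t)])
  have hpow : ((1 - t) ^ (N + 1))⁻¹ ≤ Real.exp 1 * Real.exp ((N : ℝ) ^ θ) := by
    calc ((1 - t) ^ (N + 1))⁻¹ = ((1 - t)⁻¹) ^ (N + 1) := by rw [inv_pow]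
      _ ≤ (Real.exp (2 * t)) ^ (N + 1) := pow_le_pow_left₀ (inv_nonneg.2 h1t.le) hinv1t _
      _ = Real.exp (2 * t * (N + 1)) := by rw [← Real.exp_nat_mul]; push_cast; ring_nf
      _ = Real.exp (2 * t) * Real.exp (2 * ((N : ℝ) * t)) := by rw [← Real.exp_add]; ring_nf
      _ ≤ Real.exp 1 * Real.exp ((N : ℝ) ^ θ) := by
          refine mul_le_mul (Real.exp_le_exp.2 (by linarith)) (Real.exp_le_exp.2 ?_)
            (Real.exp_nonneg _) (Real.exp_nonneg _)
          rw [hNt]; linarith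
  have hexpo : 2 * (6 * C * t ^ (η - 1)) ≤ 24 * C * (N : ℝ) ^ θ := by
    have := mul_le_mul_of_nonneg_left htη hC
    nlinarith
  calc (count d N : ℝ)
      ≤ Real.exp (2 * (6 * C * t ^ (η - 1))) * (μ ^ (N + 1) / (1 - t) ^ (N + 1)) := hmain
    _ = Real.exp (2 * (6 * C * t ^ (η - 1))) * ((1 - t) ^ (N + 1))⁻¹ * (μ * μ ^ N) := by
        rw [pow_succ]; ring
    _ ≤ Real.exp (24 * C * (N : ℝ) ^ θ) * (Real.exp 1 * Real.exp ((N : ℝ) ^ θ)) * (μ * μ ^ N) := by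
        refine mul_le_mul_of_nonneg_right (mul_le_mul (Real.exp_le_exp.2 hexpo) hpow
          (inv_nonneg.2 (pow_nonneg h1t.le _)) (Real.exp_nonneg _)) (by positivity)
    _ = Real.exp 1 * μ * Real.exp ((1 + 24 * C) * (N : ℝ) ^ θ) * μ ^ N := by
        have : Real.exp (24 * C * (N : ℝ) ^ θ) * Real.exp ((N : ℝ) ^ θ) =
            Real.exp ((1 + 24 * C) * (N : ℝ) ^ θ) := by rw [← Real.exp_add]; ring_nf
        calc Real.exp (24 * C * (N : ℝ) ^ θ) * (Real.exp 1 * Real.exp ((N : ℝ) ^ θ)) * (μ * μ ^ N)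
            = Real.exp 1 * μ * (Real.exp (24 * C * (N : ℝ) ^ θ) * Real.exp ((N : ℝ) ^ θ)) * μ ^ N := by
              ring
          _ = _ := by rw [this]

/-- **THE CESÀRO ENGINE (`∃ A K` form)** — lane «pcv-sawmu» Sketch_G12 §R61 (c) face: a Cesàro span-decay
rate with `0 < η < 1` gives `∃ A K, ∀ N ≥ 1, c_N ≤ A exp(K N^{(1−η)/(2−η)}) μ^N` (`A = e μ`, `K = 1 + 24C`).
Conditional: no `η > 0` is certified on `ℤ^d`, `d ≤ 4`. [cite: Hutchcroft2018HammersleyWelsh, Theorem 1.4 and Corollary 1.5 (mechanism)] -/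
theorem count_le_stretched_of_spanCesaroRate {C η : ℝ} (hη0 : 0 < η) (hη1 : η < 1)
    (h : BridgeSpanCesaroRate d C η) :
    ∃ A K : ℝ, ∀ N : ℕ, 1 ≤ N →
      (count d N : ℝ) ≤ A * Real.exp (K * (N : ℝ) ^ ((1 - η) / (2 - η))) * connectiveConstant d ^ N :=
  ⟨_, _, fun N hN => count_le_stretched_of_spanCesaroRate_explicit h hη0 hη1 N hN⟩

/-- The pointwise engine of `SAWBridgeSpanDecayEngine.lean` recovered through the Cesàro one (constants
`1 + 24(1 + C/(1−η))`). [cite: Hutchcroft2018HammersleyWelsh, Theorem 1.4 and Corollary 1.5 (mechanism)] -/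
theorem count_le_stretched_of_spanDecayRate_via_cesaro {C η : ℝ} (h : BridgeSpanDecayRate d C η)
    (hη0 : 0 < η) (hη1 : η < 1) :
    ∃ A K : ℝ, ∀ N : ℕ, 1 ≤ N →
      (count d N : ℝ) ≤ A * Real.exp (K * (N : ℝ) ^ ((1 - η) / (2 - η))) * connectiveConstant d ^ N :=
  count_le_stretched_of_spanCesaroRate hη0 hη1
    (bridgeSpanCesaroRate_of_decayRate h.pos.le hη0 hη1 h)

end Literature.Probability.RandomPlanarGeometry.SAW.Zd

end
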